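import Summits.ResolutionOfSingularities.ResolutionOfSingularities.Theorems.EquisingularLiftEquisingularLiftNatCompanionModelChart3
import HarnessLib

/-!
# [OURS · L1 W4.5(b) · EL♮] K-COMP-LOCAL (chart `x₂`): the strict transform of `Y : x₁x₂ + x₃² = 0` under the
# `m = 1` COMPANION touch is an affine `4`-space on the chart `x₂ ≠ 0`
# (crux `EquisingularLiftNat` = stmt-ResolutionOfSingularities-20038; K-∀n / K5-BMY lane, kill test #50)

HONEST FRAMING. OURS (cell res-hironaka, crux chain w45b, slot W4.5(b)); NOT a statement of any manuscript; replaces the role of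
NOTHING in the manuscript; AI-written, AI review is weaker than expert review. Helper `--supports stmt-ResolutionOfSingularities-20038
--as helper`. Sequel of `…NatCompanionModelChart3` (p543728: the model `𝒪_Y`, the trace family `tr = (x̄₂, x̄₃, x̄₁ȳ₁)`, chart `x₃`);
object K-COMP-LOCAL of res-L1-w45b-strat-1's STRATEGY-CENSUS v10 (sha16 0ed0c3dd766d6f34) §4 (N5.2) / §5 R2″.

THE THEOREM (N5.2 «chart `x₂` (`x₃ = x₂a`, `w = x₂b`): `Ỹ = V(x₁ + x₂a², b + a²y₁)`, regular»), sorry-free: the evaluation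
`ψ₂ : k[x₂, y₁, y₂, a] → B₂ := 𝒪_Y[(x̄₂, x̄₃, x̄₁ȳ₁)/x̄₂]`, `a ↦ x̄₃/x̄₂`, is a BIJECTION for `k` a domain (`ψ₂_bijective`); the two
relations `x̄₁ = −x̄₂·a²` (`algebraMap_x₁_eq₂`) and `b := x̄₁ȳ₁/x̄₂ = −a²·ȳ₁` (`frac_two_eq₂`) hold in `B₂`; for a field the chart is a
regular ring (`isRegularRing_B₂`). Proof as for chart `x₃`: onto by the relations and `blowupAlgebra.eval_surjective`; injective by the
left inverse `Λ₂ : 𝒪_Y[1/x̄₂] → k[x₂,y₁,y₂,a][1/x₂]`, `x₁ ↦ −x₂a²`, `x₃ ↦ x₂a`. Model coordinates `X 0, …, X 3 = x₂, y₁, y₂, a`.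

References: res-L1-w45b-strat-1 STRATEGY-CENSUS v10 N5.2; [StacksProject, Tags 052P/052Q/080E]; [GortzWedhorn2020, (13.19) p. 415].
-/

set_option linter.dupNamespace false -- mandated namespace `Summit.<Summit>.<Problem>` of this single-conjunct summit

noncomputable section

universe u

open Literature.AlgebraicGeometry.Resolution MvPolynomial

namespace Summit.ResolutionOfSingularities.ResolutionOfSingularities.Cruxes.EquisingularLiftNat.Sections

namespace CompanionModel

variable (k : Type u) [CommRing k]

/-! # Chart `x₂` (`a = x̄₂`): `B₂ = 𝒪_Y[(x̄₂,x̄₃,x̄₁ȳ₁)/x̄₂] ≅ k[x₂, y₁, y₂, a]`, `a ↦ x̄₃/x̄₂`, with `x̄₁ = −x̄₂a²`, `x̄₁ȳ₁/x̄₂ = −a²ȳ₁` -/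

/-- `a₂ε = 1`, `a₃² = −a₁a₂` ⇒ `a₁ = −a₂(a₃ε)²`. [folklore] -/
theorem rel₂_x₁ {L : Type*} [CommRing L] (a₁ a₂ a₃ e : L) (he : a₂ * e = 1) (hg : a₃ ^ 2 = -(a₁ * a₂)) :
    a₁ = -(a₂ * (a₃ * e) ^ 2) := by
  symm
  calc -(a₂ * (a₃ * e) ^ 2) = -(a₂ * a₃ ^ 2 * e ^ 2) := by ring
    _ = -(a₂ * (-(a₁ * a₂)) * e ^ 2) := by rw [hg]
    _ = a₁ * (a₂ * e) ^ 2 := by ring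
    _ = a₁ := by rw [he, one_pow, mul_one]

/-- `a₂ε = 1`, `a₃² = −a₁a₂` ⇒ `(a₁b₁)ε = −(a₃ε)²·b₁`. [folklore] -/
theorem rel₂_frac {L : Type*} [CommRing L] (a₁ a₂ a₃ b₁ e : L) (he : a₂ * e = 1) (hg : a₃ ^ 2 = -(a₁ * a₂)) :
    a₁ * b₁ * e = -((a₃ * e) ^ 2 * b₁) := by
  rw [rel₂_x₁ a₁ a₂ a₃ e he hg]
  calc -(a₂ * (a₃ * e) ^ 2) * b₁ * e = -((a₃ * e) ^ 2 * b₁) * (a₂ * e) := by ring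
    _ = -((a₃ * e) ^ 2 * b₁) := by rw [he, mul_one]

/-- The chart `B₂ = 𝒪_Y[(x̄₂, x̄₃, x̄₁ȳ₁)/x̄₂] ⊆ 𝒪_Y[1/x̄₂]`. OURS bookkeeping. -/
abbrev B₂ : Subalgebra (OY k) (Localization.Away (tr k 0)) := blowupAlgebra (Ideal.span (Set.range (tr k))) (tr k 0)

/-- The values of the model coordinates `x₂, y₁, y₂, a` in `B₂`: `x̄₂`, `ȳ₁`, `ȳ₂`, `x̄₃/x̄₂`. OURS bookkeeping. -/
def cv₂ : Fin 4 → B₂ k :=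
  ![algebraMap (OY k) (B₂ k) (mkY k (X 1)), algebraMap (OY k) (B₂ k) (mkY k (X 3)), algebraMap (OY k) (B₂ k) (mkY k (X 4)),
    blowupAlgebra.frac (tr k) 0 1]

/-- **`ψ₂ : k[x₂, y₁, y₂, a] → B₂`**, `a ↦ x̄₃/x̄₂` (model coordinates `X 0, …, X 3 = x₂, y₁, y₂, a`). OURS bookkeeping. -/
def ψ₂ : MvPolynomial (Fin 4) k →+* B₂ k :=
  MvPolynomial.eval₂Hom ((algebraMap (OY k) (B₂ k)).comp ((mkY k).comp MvPolynomial.C)) (cv₂ k)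

/-- `x̄₂ · (1/x̄₂) = 1` in `𝒪_Y[1/x̄₂]`. [folklore] -/
theorem x₂_mul_invSelf :
    algebraMap (OY k) (Localization.Away (tr k 0)) (tr k 0) * IsLocalization.Away.invSelf (tr k 0) = 1 :=
  IsLocalization.Away.mul_invSelf (S := Localization.Away (tr k 0)) (tr k 0)

/-- `x̄₃² = −x̄₁x̄₂` in `𝒪_Y[1/x̄₂]`. [folklore] -/
theorem sq_x₃_eq_loc₂ :
    algebraMap (OY k) (Localization.Away (tr k 0)) (mkY k (X 2)) ^ 2 =
      -(algebraMap (OY k) (Localization.Away (tr k 0)) (mkY k (X 0)) *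
        algebraMap (OY k) (Localization.Away (tr k 0)) (tr k 0)) := by
  change _ = -(_ * algebraMap (OY k) (Localization.Away (tr k 0)) (mkY k (X 1)))
  rw [← map_pow, sq_x₃_eq, map_neg, map_mul]

/-- `ψ₂` on constants. [folklore] -/
theorem ψ₂_C (a : k) : ψ₂ k (C a) = algebraMap (OY k) (B₂ k) (mkY k (C a)) := MvPolynomial.eval₂Hom_C _ _ a

/-- `ψ₂ x₂ = x̄₂`. [folklore] -/
theorem ψ₂_X₀ : ψ₂ k (X 0) = algebraMap (OY k) (B₂ k) (mkY k (X 1)) := MvPolynomial.eval₂Hom_X' _ _ 0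

/-- `ψ₂ y₁ = ȳ₁`. [folklore] -/
theorem ψ₂_X₁ : ψ₂ k (X 1) = algebraMap (OY k) (B₂ k) (mkY k (X 3)) := MvPolynomial.eval₂Hom_X' _ _ 1

/-- `ψ₂ y₂ = ȳ₂`. [folklore] -/
theorem ψ₂_X₂ : ψ₂ k (X 2) = algebraMap (OY k) (B₂ k) (mkY k (X 4)) := MvPolynomial.eval₂Hom_X' _ _ 2

/-- `ψ₂ a = x̄₃/x̄₂`. [folklore] -/
theorem ψ₂_X₃ : ψ₂ k (X 3) = blowupAlgebra.frac (tr k) 0 1 := MvPolynomial.eval₂Hom_X' _ _ 3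

/-- **N5.2 chart `x₂`, first relation: `x̄₁ = −x̄₂·a²` in `B₂`.** [folklore] -/
theorem algebraMap_x₁_eq₂ : algebraMap (OY k) (B₂ k) (mkY k (X 0)) = -(ψ₂ k (X 0) * ψ₂ k (X 3) ^ 2) := by
  rw [ψ₂_X₀, ψ₂_X₃]
  apply Subtype.ext
  rw [Subalgebra.coe_neg, Subalgebra.coe_mul, Subalgebra.coe_pow, blowupAlgebra.coe_frac]
  exact rel₂_x₁ _ _ _ _ (x₂_mul_invSelf k) (sq_x₃_eq_loc₂ k)

/-- **N5.2 chart `x₂`, second relation: `b := x̄₁ȳ₁/x̄₂ = −a²·ȳ₁` in `B₂`.** [folklore] -/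
theorem frac_two_eq₂ : blowupAlgebra.frac (tr k) 0 2 = -(ψ₂ k (X 3) ^ 2 * ψ₂ k (X 1)) := by
  rw [ψ₂_X₁, ψ₂_X₃]
  apply Subtype.ext
  rw [blowupAlgebra.coe_frac, Subalgebra.coe_neg, Subalgebra.coe_mul, Subalgebra.coe_pow, blowupAlgebra.coe_frac]
  change algebraMap (OY k) (Localization.Away (tr k 0)) (mkY k (X 0 * X 3)) * IsLocalization.Away.invSelf (tr k 0) =
    -((algebraMap (OY k) (Localization.Away (tr k 0)) (mkY k (X 2)) * IsLocalization.Away.invSelf (tr k 0)) ^ 2 *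
      algebraMap (OY k) (Localization.Away (tr k 0)) (mkY k (X 3)))
  rw [map_mul, map_mul]
  exact rel₂_frac _ _ _ _ _ (x₂_mul_invSelf k) (sq_x₃_eq_loc₂ k)

/-- `x̄₃ = x̄₂ · a` in `B₂`. [folklore] -/
theorem algebraMap_x₃_eq₂ : algebraMap (OY k) (B₂ k) (mkY k (X 2)) = ψ₂ k (X 0) * ψ₂ k (X 3) := by
  rw [ψ₂_X₀, ψ₂_X₃]
  apply Subtype.ext
  rw [Subalgebra.coe_mul, blowupAlgebra.coe_frac]
  exact rel_x₂ _ _ _ (x₂_mul_invSelf k)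

/-- Every `x̄ⱼ` lies in the image of `ψ₂`. [folklore] -/
theorem algebraMap_X_mem_range₂ (j : Fin 5) : algebraMap (OY k) (B₂ k) (mkY k (X j)) ∈ (ψ₂ k).range := by
  match j with
  | ⟨0, _⟩ =>
    exact (show algebraMap (OY k) (B₂ k) (mkY k (X 0)) ∈ (ψ₂ k).range from
      ⟨-(X 0 * X 3 ^ 2), by rw [map_neg, map_mul, map_pow, ← algebraMap_x₁_eq₂]⟩)
  | ⟨1, _⟩ => exact ⟨X 0, ψ₂_X₀ k⟩
  | ⟨2, _⟩ =>
    exact (show algebraMap (OY k) (B₂ k) (mkY k (X 2)) ∈ (ψ₂ k).range from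
      ⟨X 0 * X 3, by rw [map_mul, ← algebraMap_x₃_eq₂]⟩)
  | ⟨3, _⟩ => exact ⟨X 1, ψ₂_X₁ k⟩
  | ⟨4, _⟩ => exact ⟨X 2, ψ₂_X₂ k⟩

/-- Every constant lies in the image of `ψ₂`. [folklore] -/
theorem algebraMap_mem_range₂ (y : OY k) : algebraMap (OY k) (B₂ k) y ∈ (ψ₂ k).range := by
  obtain ⟨G, rfl⟩ := Ideal.Quotient.mk_surjective y
  induction G using MvPolynomial.induction_on with
  | C a => exact ⟨C a, ψ₂_C k a⟩
  | add p q hp hq => rw [map_add, map_add]; exact add_mem hp hq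
  | mul_X p j hp => rw [map_mul, map_mul]; exact mul_mem hp (algebraMap_X_mem_range₂ k j)

/-- Every fraction `x/x̄₂` lies in the image of `ψ₂`. [folklore] -/
theorem frac_mem_range₂ (j : Fin 3) : blowupAlgebra.frac (tr k) 0 j ∈ (ψ₂ k).range := by
  have h0 : blowupAlgebra.frac (tr k) 0 0 ∈ (ψ₂ k).range := by
    refine ⟨1, ?_⟩
    rw [map_one]
    apply Subtype.ext
    rw [blowupAlgebra.coe_frac, OneMemClass.coe_one]
    exact (x₂_mul_invSelf k).symm
  match j with
  | ⟨0, _⟩ => exact h0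
  | ⟨1, _⟩ => exact ⟨X 3, ψ₂_X₃ k⟩
  | ⟨2, _⟩ =>
    exact (show blowupAlgebra.frac (tr k) 0 2 ∈ (ψ₂ k).range from
      ⟨-(X 3 ^ 2 * X 1), by rw [map_neg, map_mul, map_pow, ← frac_two_eq₂]⟩)

/-- **`ψ₂` is onto.** [folklore] -/
theorem ψ₂_surjective : Function.Surjective (ψ₂ k) := by
  intro z
  obtain ⟨F, rfl⟩ := blowupAlgebra.eval_surjective (tr k) 0 z
  suffices h : (blowupAlgebra.eval (tr k) 0 F) ∈ (ψ₂ k).range by exact h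
  induction F using MvPolynomial.induction_on with
  | C y => rw [blowupAlgebra.eval_C]; exact algebraMap_mem_range₂ k y
  | add p q hp hq => rw [map_add]; exact add_mem hp hq
  | mul_X p j hp => rw [map_mul, blowupAlgebra.eval_X]; exact mul_mem hp (frac_mem_range₂ k j.1)

/-- The inverse substitution `x₁ ↦ −x₂a², x₂ ↦ x₂, x₃ ↦ x₂a, y₁ ↦ y₁, y₂ ↦ y₂`. OURS bookkeeping. -/
def lamVal₂ : Fin 5 → MvPolynomial (Fin 4) k := ![-(X 0 * X 3 ^ 2), X 0, X 0 * X 3, X 1, X 2]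

/-- `x₁ ↦ −x₂a²`. [folklore] -/
theorem lamVal₂_zero : lamVal₂ k 0 = -(X 0 * X 3 ^ 2) := rfl

/-- `x₂ ↦ x₂`. [folklore] -/
theorem lamVal₂_one : lamVal₂ k 1 = X 0 := rfl

/-- `x₃ ↦ x₂a`. [folklore] -/
theorem lamVal₂_two : lamVal₂ k 2 = X 0 * X 3 := rfl

/-- `y₁ ↦ y₁`. [folklore] -/
theorem lamVal₂_three : lamVal₂ k 3 = X 1 := rfl

/-- `y₂ ↦ y₂`. [folklore] -/
theorem lamVal₂_four : lamVal₂ k 4 = X 2 := rfl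

/-- The substitution kills `g`. [folklore] -/
theorem subst_gY₂ : MvPolynomial.eval₂Hom MvPolynomial.C (lamVal₂ k) (gY k) = 0 := by
  simp only [gY, map_add, map_mul, map_pow, MvPolynomial.eval₂Hom_X', lamVal₂_zero, lamVal₂_one, lamVal₂_two]
  ring

/-- `λ₂ : 𝒪_Y → k[x₂,y₁,y₂,a][1/x₂]`. OURS bookkeeping. -/
def lam₂ : OY k →+* Localization.Away (X 0 : MvPolynomial (Fin 4) k) :=
  Ideal.Quotient.lift (Ideal.span {gY k})
    ((algebraMap (MvPolynomial (Fin 4) k) (Localization.Away (X 0 : MvPolynomial (Fin 4) k))).comp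
      (MvPolynomial.eval₂Hom MvPolynomial.C (lamVal₂ k)))
    (fun a ha => by
      obtain ⟨b, rfl⟩ := Ideal.mem_span_singleton'.mp ha
      rw [RingHom.comp_apply, map_mul, subst_gY₂, mul_zero, map_zero])

/-- `λ₂` on classes. [folklore] -/
theorem lam₂_mkY (F : MvPolynomial (Fin 5) k) :
    lam₂ k (mkY k F) = algebraMap (MvPolynomial (Fin 4) k) (Localization.Away (X 0 : MvPolynomial (Fin 4) k))
      (MvPolynomial.eval₂Hom MvPolynomial.C (lamVal₂ k) F) :=
  Ideal.Quotient.lift_mk _ _ _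

/-- `λ₂(x̄₂) = x₂`. [folklore] -/
theorem lam₂_tr_zero : lam₂ k (tr k 0) =
    algebraMap (MvPolynomial (Fin 4) k) (Localization.Away (X 0 : MvPolynomial (Fin 4) k)) (X 0) := by
  change lam₂ k (mkY k (X 1)) = _
  rw [lam₂_mkY, MvPolynomial.eval₂Hom_X', lamVal₂_one]

/-- `λ₂(x̄₂)` is a unit. [folklore] -/
theorem isUnit_lam₂_tr_zero : IsUnit (lam₂ k (tr k 0)) := by
  rw [lam₂_tr_zero]
  exact IsLocalization.Away.algebraMap_isUnit (X 0 : MvPolynomial (Fin 4) k)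

/-- **`Λ₂ : 𝒪_Y[1/x̄₂] → k[x₂,y₁,y₂,a][1/x₂]`**, the left inverse of `ψ₂` after localisation. OURS bookkeeping. -/
def Λ₂ : Localization.Away (tr k 0) →+* Localization.Away (X 0 : MvPolynomial (Fin 4) k) :=
  IsLocalization.Away.lift (tr k 0) (isUnit_lam₂_tr_zero k)

/-- `Λ₂` extends `λ₂`. [folklore] -/
theorem Λ₂_algebraMap (y : OY k) : Λ₂ k (algebraMap (OY k) (Localization.Away (tr k 0)) y) = lam₂ k y :=
  IsLocalization.Away.lift_eq (tr k 0) (isUnit_lam₂_tr_zero k) y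

/-- `Λ₂` on a fraction `r/x̄₂`: if `λ₂ r = t · λ₂ x̄₂` then `Λ₂ (r/x̄₂) = t`. [folklore] -/
theorem Λ₂_frac {r : OY k} {t : Localization.Away (X 0 : MvPolynomial (Fin 4) k)} (h : lam₂ k r = t * lam₂ k (tr k 0)) :
    Λ₂ k (algebraMap (OY k) (Localization.Away (tr k 0)) r * IsLocalization.Away.invSelf (tr k 0)) = t := by
  refine (isUnit_lam₂_tr_zero k).mul_left_injective ?_
  dsimp only
  rw [← h, ← Λ₂_algebraMap k (tr k 0), ← map_mul, mul_assoc, mul_comm (IsLocalization.Away.invSelf (tr k 0)),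
    x₂_mul_invSelf, mul_one, Λ₂_algebraMap]

/-- **`Λ₂ ∘ ψ₂ = (k[x₂,y₁,y₂,a] → k[x₂,y₁,y₂,a][1/x₂])`.** [folklore] -/
theorem Λ₂_comp_ψ₂ :
    (Λ₂ k).comp (((B₂ k).val : B₂ k →+* Localization.Away (tr k 0)).comp (ψ₂ k)) =
      algebraMap (MvPolynomial (Fin 4) k) (Localization.Away (X 0 : MvPolynomial (Fin 4) k)) := by
  refine MvPolynomial.ringHom_ext (fun a => ?_) (fun j => ?_)
  · rw [RingHom.comp_apply, RingHom.comp_apply, ψ₂_C]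
    change Λ₂ k (algebraMap (OY k) (Localization.Away (tr k 0)) (mkY k (C a))) = _
    rw [Λ₂_algebraMap, lam₂_mkY, MvPolynomial.eval₂Hom_C]
  · rw [RingHom.comp_apply, RingHom.comp_apply]
    match j with
    | ⟨0, _⟩ =>
      change Λ₂ k ((ψ₂ k (X 0) : B₂ k) : Localization.Away (tr k 0)) = algebraMap _ _ (X 0)
      rw [ψ₂_X₀]
      change Λ₂ k (algebraMap (OY k) (Localization.Away (tr k 0)) (mkY k (X 1))) = _
      rw [Λ₂_algebraMap, lam₂_mkY, MvPolynomial.eval₂Hom_X']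
      rfl
    | ⟨1, _⟩ =>
      change Λ₂ k ((ψ₂ k (X 1) : B₂ k) : Localization.Away (tr k 0)) = algebraMap _ _ (X 1)
      rw [ψ₂_X₁]
      change Λ₂ k (algebraMap (OY k) (Localization.Away (tr k 0)) (mkY k (X 3))) = _
      rw [Λ₂_algebraMap, lam₂_mkY, MvPolynomial.eval₂Hom_X']
      rfl
    | ⟨2, _⟩ =>
      change Λ₂ k ((ψ₂ k (X 2) : B₂ k) : Localization.Away (tr k 0)) = algebraMap _ _ (X 2)
      rw [ψ₂_X₂]
      change Λ₂ k (algebraMap (OY k) (Localization.Away (tr k 0)) (mkY k (X 4))) = _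
      rw [Λ₂_algebraMap, lam₂_mkY, MvPolynomial.eval₂Hom_X']
      rfl
    | ⟨3, _⟩ =>
      change Λ₂ k ((ψ₂ k (X 3) : B₂ k) : Localization.Away (tr k 0)) = algebraMap _ _ (X 3)
      rw [ψ₂_X₃, blowupAlgebra.coe_frac]
      refine Λ₂_frac k ?_
      change lam₂ k (mkY k (X 2)) = _
      rw [lam₂_tr_zero, lam₂_mkY, MvPolynomial.eval₂Hom_X', ← map_mul, lamVal₂_two, mul_comm]

/-- **`ψ₂` is injective** (`k` a domain). [folklore] -/
theorem ψ₂_injective [IsDomain k] : Function.Injective (ψ₂ k) := by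
  have hinj : Function.Injective
      (algebraMap (MvPolynomial (Fin 4) k) (Localization.Away (X 0 : MvPolynomial (Fin 4) k))) :=
    IsLocalization.injective _ (powers_le_nonZeroDivisors_of_noZeroDivisors (MvPolynomial.X_ne_zero 0))
  rw [← Λ₂_comp_ψ₂, RingHom.coe_comp, RingHom.coe_comp] at hinj
  exact hinj.of_comp.of_comp

/-- **K-COMP-LOCAL, chart `x₂` (N5.2): `ψ₂ : k[x₂, y₁, y₂, a] → B₂` is a bijection**; relations `x̄₁ = −x̄₂a²`,
`x̄₁ȳ₁/x̄₂ = −a²ȳ₁` (N5.2: «`Ỹ = V(x₁ + x₂a², b + a²y₁)`»). OURS. -/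
theorem ψ₂_bijective [IsDomain k] : Function.Bijective (ψ₂ k) :=
  ⟨ψ₂_injective k, ψ₂_surjective k⟩

/-- **The chart `B₂` is a regular ring** (over a field). OURS. -/
theorem isRegularRing_B₂ (K : Type u) [Field K] : IsRegularRing (B₂ K) :=
  IsRegularRing.of_ringEquiv (RingEquiv.ofBijective (ψ₂ K) (ψ₂_bijective K))


end CompanionModel

end Summit.ResolutionOfSingularities.ResolutionOfSingularities.Cruxes.EquisingularLiftNat.Sections
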